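import Literature.NumberTheory.EllipticCurves.TianYuanZhang2017.GenusFieldFamily
import Literature.NumberTheory.EllipticCurves.HeathBrown1994.CongruentTwoSelmerMonskyMatrix
import HarnessLib

/-!
# Smith 2016, Theorem 2.2, row `1` AS PRINTED: for square-free `n ≡ 1 (mod 8)`, Tian–Yuan–Zhang's genus sum `ℒ₁(n) = Σ_{n = d₀⋯d_ℓ, dᵢ ≡ 1 (8)} ∏ᵢ g(dᵢ)` equals `det M₁`, `M₁ = (A + Aᵀ, Aᵀ; A, D_z)`, in `𝔽₂`

Topic `NumberTheory/EllipticCurves`, namespace `Literature.NumberTheory.EllipticCurves.Smith2016`.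
Statement-only file: ONE named fact (a published theorem — a finite identity over `𝔽₂` between Legendre
symbols and parities of genus class numbers — vendored as a `Prop`, nothing asserted, D-0014), in the
tree's vocabulary (`TianYuanZhang2017.genusSum₁`, `genusClassNumber`, `GenusField`; Monsky's
`HeathBrown1994.legendreMatrix`, `legendreDiagonal`).  Consequences (Smith's Theorem 1.2 and the journal
Theorem 1.2 of Tian–Yuan–Zhang on `n ≡ 1 (mod 8)` relative to this one identity) and its discharge for one
and two prime factors are in the sibling proof files `CongruentNumberGenusDeterminantConsequences`,
`CongruentNumberSmithMatrixSelmer`, `CongruentNumberRedeiDeterminant`.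

## The source, verbatim (held text `paper:arxiv-1603.08479`, LaTeX-derived chunks)

A. Smith, *The congruent numbers have positive natural density*, arXiv:1603.08479v2 (2016)
[Smith2016CongruentDensity], §2 (chunk p0005):
* L5–L24: "`(d/p)₊ := ½(1 − (d/p))` … an element of `𝔽₂`. Write the odd part of `n` as a product
  `p₁p₂⋯p_r` of odd primes. … `yᵢ := (−1/pᵢ)₊` … `zᵢ := (2/pᵢ)₊` … `A_ij = (p_j/p_i)₊` for `i ≠ j`,
  `A_ii = Σ_{j ≠ i} A_ij` … `D_v` the diagonal matrix so that `(D_v)_ii = vᵢ`."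
* L26–L27: "take `g(n) ∈ 𝔽₂` to be the order of `2Cl(ℚ(√−n))` mod `2`."
* L34–L44, **Definition.** "Take `ℒ : ℤ → 𝔽₂` to be the recursive function defined by `ℒ(1) = 1`; if
  `n ≡ 1 (8)` is positive and squarefree, and if `p` is any prime divisor of `n`,
  `ℒ(n) = Σ_{p ∣ d ∣ n, d ≡ 1 (8)} g(d) ℒ(n/d)`; otherwise, `ℒ(n) = 0`."  (Unrolled, for square-free
  `n ≡ 1 (mod 8)`: `ℒ(n) = Σ ∏ᵢ g(dᵢ)` over the non-ordered decompositions `n = d₀⋯d_ℓ` into factors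
  `dᵢ > 1`, all `≡ 1 (mod 8)` — Tian–Yuan–Zhang's first genus sum, Thm. 1.1 of [TianYuanZhang2017], which
  is Smith's Theorem 2.1: "`ℒ(E⁽ⁿ⁾) ≡ ℒ_x(n) mod 2`"; the tree's `genusSum₁ n g` read in `ZMod 2`: for
  `n ≡ 1 (mod 8)` a decomposition with at most one factor `≢ 1 (mod 8)` has none.)
* L59–L61, **Theorem 2.2.** "With `A`, `y`, and `z` defined from `n` as above, the second and third columns
  of Table 1 are equal in the rows corresponding to `n mod 8`."  Row `1` of Table 1: second column `ℒ(n)`,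
  third column the matrix `M₁ = M₁(A, z)`; chunk p0005 L63: "We will refer to the matrix in the third
  column row `x` of this table by `M_x`"; chunk p0006 L13: "to show that `ℒ(n) = det M₁` for all `n`, we
  just need to show that (eq:n1rec) is satisfied with `det M₁` replacing `ℒ`" (Proposition 2.4).  The
  matrix `M₁(A, z)` is `(A + Aᵀ, Aᵀ; A, D_z)` (§2.2, chunk p0008 L42: the bordered expansion
  `|A + Aᵀ, Aᵀ, u; A, D_z, 0; uᵀ, 0, 0| = Σ_S det O(A, z, u)[S] · det M₁(A, z)[S′]`); it is Monsky's
  `M₂` (appendix to Heath-Brown 1994, typescript p. 40 L19–L24), cf. the proof of Thm. 1.2 (chunk p0005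
  L65–L69): "Per Monsky's calculations in [Heat94], `rk(Sel⁽²⁾(E⁽ⁿ⁾)) = 2 + crnk(M₁)` for `n ≡ 1 (8)`."

Table 1 itself is a LaTeX table absent from the held text layer; the shape of `M₁` is read off §2.2 /
Prop. 2.4 as quoted, and the identity was confirmed by the lineage on random symbol data (`r ≤ 6`,
3000/3000, cell `bsd-monsky` prover-B g17, `work/smith/`) — evidence for the transcription, not an input.
SOURCE TIER: arXiv preprint (2016), cited as a theorem by Tian, Proc. ICM 2022 [Tian2023CongruentICM]
(Thm. 15, "(Smith)") — the registry tiers it.  The rows `2, 3, 5a, 5b, 6, 7a, 7b` of Table 1 are NOT typed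
here.  -- TODO(general form): rows 2 and 3 (`n ≡ 2, 3 (mod 8)`) and the bordered rows `5a–7b`.

## Transcription (tree dictionary)

* "`n ≡ 1 (8)` positive and squarefree", "`p₁⋯p_r` the odd part": an injective tuple `p : Fin k → ℕ` of
  odd primes with `(∏ pᵢ) % 8 = 1`; `n = ∏ pᵢ`.
* `A`, `D_z`: the tree's `HeathBrown1994.legendreMatrix p` (`A_ij = (p_j/p_i)₊`, `A_ii = Σ_{j≠i} A_ij` —
  literally Smith's `A`) and `legendreDiagonal p 2` (`= D_z`, `zᵢ = (2/pᵢ)₊ = addLegendreSym 2 (p i)`);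
  `M₁ = Matrix.fromBlocks (A + Aᵀ) Aᵀ A D_z` on `Fin k ⊕ Fin k`.
* `g(d)` = "the order of `2Cl(ℚ(√−d))` mod 2": `TianYuanZhang2017.genusClassNumber (GenusField d)`
  (`#{squares in Cl(𝓞_{ℚ(√−d)})}`, `GenusField d = ℚ[X]/(X² + d)`) cast to `ZMod 2`.
* `ℒ(n) = ℒ₁(n)`: `(TianYuanZhang2017.genusSum₁ n g : ZMod 2)`.
No `_holds` in this file; the lineage's programme (HOME/proof/PROOF-B-SMITH22-note.md of cell
`bsd-monsky`) is a kernel proof for every `k` via the coefficient formula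
`[z^T] det M₁ = Σ_{|I| = |T|} y^I det A[T′, I′]` and a forest/pairing argument; `k ≤ 2` is discharged in
`CongruentNumberGenusDeterminantConsequences`.

## References
* [Smith2016CongruentDensity] A. Smith, arXiv:1603.08479v2 (2016), §2: definitions (chunk p0005 L5–L44),
  Thm. 2.1 (L48–L55), Thm. 2.2 (L59–L63), proof of Thm. 1.2 (L65–L75), Prop. 2.4 (chunk p0006 L15–L34),
  §2.2 (chunk p0008 L42).
* [TianYuanZhang2017] Y. Tian, X. Yuan, S.-W. Zhang, Asian J. Math. 21 (2017), Thm. 1.1.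
* [HeathBrown1994SelmerCongruentII] Appendix by P. Monsky, typescript p. 39 L10–L33, p. 40 L19–L24.
* [Tian2023CongruentICM] Y. Tian, Proc. ICM 2022, Thm. 15.
-/

namespace Literature.NumberTheory.EllipticCurves.Smith2016

open Literature.NumberTheory.EllipticCurves.HeathBrown1994
open Literature.NumberTheory.EllipticCurves.TianYuanZhang2017

/-- **Smith 2016, Theorem 2.2, row `1`** (verbatim in the module docstring): for `n = p₁⋯p_k ≡ 1 (mod 8)`
a product of distinct odd primes, Tian–Yuan–Zhang's first genus sum
`ℒ₁(n) = Σ_{n = d₀⋯d_ℓ, dᵢ ≡ 1 (8)} ∏ᵢ g(dᵢ)` (`genusSum₁`, `g(d) = #2Cl(ℚ(√−d))` via `GenusField`) and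
the determinant of `M₁ = (A + Aᵀ, Aᵀ; A, D_z)` (`A = legendreMatrix p`, `D_z = legendreDiagonal p 2`)
agree in `𝔽₂`: "`ℒ(n) = det M₁`".  A THEOREM in print (Prop. 2.4, an involution count), vendored as a named
fact; discharged in the tree for `k ≤ 2` (`CongruentNumberGenusDeterminantConsequences`).
[cite: Smith2016CongruentDensity, Thm. 2.2 row 1 (arXiv:1603.08479 §2, chunk p0005 L59–L63) with the Definition of ℒ (L34–L44), Prop. 2.4 (chunk p0006 L13–L34) and §2.2 (chunk p0008 L42)] -/
def smith_thm22_rowOne : Prop :=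
  ∀ (k : ℕ) (p : Fin k → ℕ), (∀ i, (p i).Prime) → (∀ i, Odd (p i)) → Function.Injective p →
    (∏ i, p i) % 8 = 1 →
      ((genusSum₁ (∏ i, p i) (fun d => genusClassNumber (GenusField d)) : ℕ) : ZMod 2) =
        (Matrix.fromBlocks (legendreMatrix p + (legendreMatrix p).transpose) (legendreMatrix p).transpose
          (legendreMatrix p) (legendreDiagonal p 2)).det

end Literature.NumberTheory.EllipticCurves.Smith2016
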